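/-
VALUE = THEOREM (the unipotent orbit sums of the all-`p` reflection-class certificate), NOT summit
progress (cell b2b-lgcu-borel, gen 24); the crux item stmt-MatrixMultiplication-14079 is untouched.
-/
import Mathlib
import Literature.NumberTheory.QuadraticFields.ChowlaCentralFactorialProofs
import Literature.NumberTheory.EllipticCurves.BinaryQuarticDiscriminantFpCountProofs
import Summits.MatrixMultiplication.MatrixMultiplication.Theorems.SubgroupIdentityDesigns.Negative.ReflectionClassCharSums
import Summits.MatrixMultiplication.MatrixMultiplication.Theorems.SubgroupIdentityDesigns.Negative.ReflectionClassSphere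

/-!
# Unipotent orbit sums of the unified weight vanish, for every odd prime `p`

VALUE = THEOREM (generic in the odd prime `p`), NOT summit progress; the crux item
stmt-MatrixMultiplication-14079 is untouched and remains open.

Layer F5 of the all-`p` proof of the unified reflection-class certificate (ORACLE-g24 §G24-1 (U),
§G24-2).  Fix an isotropic `x ≠ 0` in `𝔽_p³` (`Q(x) = x·x = 0`) and an anisotropic `y ⊥ x`.  The
Siegel transformations `E_α = siegel x (α • y)`, `α ∈ 𝔽_p`,
`E_α v = v + α(v·x) y − α(v·y) x − (α² Q(y)/2)(v·x) x`, are isometries fixing `x`; the successor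
layers identify them with the stabiliser of `x` in the reflection class group.  For a level `c`
with `−c` a non-square, a base point `X₀` and any `ω` on the sphere `Q = c`:

  `orbitU_sum :  Σ_α  wt c X₀ (E_α ω) = 0`.

Proof: `(E_α ω)·X₀ = Aα² + Bα + C`, `A ≠ 0`; the latitude form of the weight turns the sum into
three quadratic character sums plus `p`·(root counts); freeness (`siegel_smul_inj`) pins the
discriminants, and for `p ≡ 3 (mod 4)` the TANGENCY LEMMA `disc₀_ne_zero` controls the extra term.
HONEST SCOPE.  One of the two orbit types; by itself it excludes nothing.
-/

set_option linter.dupNamespace false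

open scoped BigOperators Matrix

namespace Summit.MatrixMultiplication.MatrixMultiplication.Theorems.SubgroupIdentityDesigns.Negative
namespace ReflectionClassOrbitU

open ReflectionClassCertificate (V chi wt)
open ReflectionClassSphere (lat wt_eq_lat dot_ne_zero_of_isotropic
  neg_dot_isSquare_of_perp_isotropic eq_base_iff eq_neg_base_iff chi_eq ne_zero_of_nonsquare
  exists_smul_of_cross_eq_zero)
open ReflectionClassCharSums (sum_quadratic)
open Literature.NumberTheory.QuadraticFields.ChowlaProof (ringChar_ne_two)
open Literature.NumberTheory.EllipticCurves.BinaryQuartic (two_ne_zero_zmod)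

variable {p : ℕ} [hp : Fact p.Prime]

/-! ## Siegel transformations -/

/-- The Siegel transformation `E_{x,y} v = v + (v·x) y − (v·y) x − (Q(y)/2)(v·x) x`. -/
def siegel (x y v : V p) : V p :=
  v + (v ⬝ᵥ x) • y - (v ⬝ᵥ y) • x - ((y ⬝ᵥ y) / 2 * (v ⬝ᵥ x)) • x

/-- Leading coefficient `A = −(Q(y)/2)(ω·x)(x·X₀)` of the latitude polynomial. -/
def coefA (x y X₀ ω : V p) : ZMod p := -((y ⬝ᵥ y) / 2 * (ω ⬝ᵥ x) * (x ⬝ᵥ X₀))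

/-- Linear coefficient `B = (ω·x)(y·X₀) − (ω·y)(x·X₀)` of the latitude polynomial. -/
def coefB (x y X₀ ω : V p) : ZMod p := (ω ⬝ᵥ x) * (y ⬝ᵥ X₀) - (ω ⬝ᵥ y) * (x ⬝ᵥ X₀)

section Siegel

variable {x y : V p}

/-- `E_{x,y}` preserves `v·x` (`x` isotropic, `y ⊥ x`). -/
theorem siegel_dot_x (hxx : x ⬝ᵥ x = 0) (hyx : y ⬝ᵥ x = 0) (v : V p) :
    siegel x y v ⬝ᵥ x = v ⬝ᵥ x := by
  simp only [siegel, add_dotProduct, sub_dotProduct, smul_dotProduct, smul_eq_mul, hxx, hyx,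
    mul_zero, add_zero, sub_zero]

/-- `(E_{x,γy} v)·y = v·y + γ (v·x) Q(y)` (`y ⊥ x`). -/
theorem siegel_smul_dot_y (hyx : y ⬝ᵥ x = 0) (v : V p) (γ : ZMod p) :
    siegel x (γ • y) v ⬝ᵥ y = v ⬝ᵥ y + γ * ((v ⬝ᵥ x) * (y ⬝ᵥ y)) := by
  have hxy : x ⬝ᵥ y = 0 := by rw [dotProduct_comm]; exact hyx
  simp only [siegel, add_dotProduct, sub_dotProduct, smul_dotProduct, dotProduct_smul, smul_eq_mul,
    hxy, mul_zero, sub_zero]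
  ring

/-- `E_{x,y}` is an isometry (`p ≠ 2`, `x` isotropic, `y ⊥ x`). -/
theorem siegel_dot_self (hp2 : p ≠ 2) (hxx : x ⬝ᵥ x = 0) (hyx : y ⬝ᵥ x = 0) (v : V p) :
    siegel x y v ⬝ᵥ siegel x y v = v ⬝ᵥ v := by
  have hxy : x ⬝ᵥ y = 0 := by rw [dotProduct_comm]; exact hyx
  have h2 : (2 : ZMod p) ≠ 0 := two_ne_zero_zmod hp2
  obtain ⟨r, hr⟩ : ∃ r : ZMod p, y ⬝ᵥ y = 2 * r := ⟨y ⬝ᵥ y / 2, by field_simp⟩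
  simp only [siegel, add_dotProduct, dotProduct_add, sub_dotProduct, dotProduct_sub,
    smul_dotProduct, dotProduct_smul, smul_eq_mul, hxx, hyx, hxy, dotProduct_comm y v,
    dotProduct_comm x v, hr, mul_div_cancel_left₀ r h2]
  ring

/-- The latitude of `E_{x,αy} ω` is quadratic in `α`: `(E_{x,αy} ω)·X₀ = A α² + B α + ω·X₀`. -/
theorem siegel_smul_dot (x y X₀ ω : V p) (α : ZMod p) :
    siegel x (α • y) ω ⬝ᵥ X₀ = coefA x y X₀ ω * α ^ 2 + coefB x y X₀ ω * α + ω ⬝ᵥ X₀ := by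
  simp only [siegel, coefA, coefB, add_dotProduct, sub_dotProduct, smul_dotProduct, dotProduct_smul,
    smul_eq_mul]
  ring

/-- **Freeness:** `E_{x,αy} ω = E_{x,βy} ω` forces `α = β` when `ω·x ≠ 0`, `Q(y) ≠ 0`. -/
theorem siegel_smul_inj (hyx : y ⬝ᵥ x = 0) (hy : y ⬝ᵥ y ≠ 0) {ω : V p} (hωx : ω ⬝ᵥ x ≠ 0)
    {α β : ZMod p} (h : siegel x (α • y) ω = siegel x (β • y) ω) : α = β := by
  have h1 := congrArg (fun v => v ⬝ᵥ y) h
  simp only [siegel_smul_dot_y hyx] at h1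
  exact mul_right_cancel₀ (mul_ne_zero hωx hy) (add_left_cancel h1)

end Siegel

/-! ## Root counts of quadratics -/

/-- `#{α : Aα² + Bα + E = 0} = 1 + χ(B² − 4AE)` for `A ≠ 0`, `p ≠ 2`. -/
theorem card_roots (hp2 : p ≠ 2) {A : ZMod p} (hA : A ≠ 0) (B E : ZMod p) :
    ((Finset.univ.filter fun α : ZMod p => A * α ^ 2 + B * α + E = 0).card : ℤ) =
      1 + quadraticChar (ZMod p) (B ^ 2 - 4 * A * E) := by
  have h2 : (2 : ZMod p) ≠ 0 := two_ne_zero_zmod hp2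
  have h4A : 4 * A ≠ 0 := by
    rw [show (4 : ZMod p) * A = 2 * (2 * A) by ring]
    exact mul_ne_zero h2 (mul_ne_zero h2 hA)
  have key : ∀ α : ZMod p,
      A * α ^ 2 + B * α + E = 0 ↔ (2 * A * α + B) ^ 2 = B ^ 2 - 4 * A * E := by
    intro α
    constructor
    · intro h; linear_combination (4 * A) * h
    · intro h
      have : 4 * A * (A * α ^ 2 + B * α + E) = 4 * A * 0 := by linear_combination h
      exact mul_left_cancel₀ h4A this
  have hcard : (Finset.univ.filter fun α : ZMod p => A * α ^ 2 + B * α + E = 0).card =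
      (Finset.univ.filter fun v : ZMod p => v ^ 2 = B ^ 2 - 4 * A * E).card := by
    refine Finset.card_equiv (((Units.mk0 (2 * A) (mul_ne_zero h2 hA)).mulLeft).trans
      (Equiv.addRight B)) ?_
    intro α
    simp only [Finset.mem_filter, Finset.mem_univ, true_and, Equiv.trans_apply,
      Units.mulLeft_apply, Units.val_mk0, Equiv.coe_addRight, key]
  have hs := quadraticChar_card_sqrts (ringChar_ne_two hp2) (B ^ 2 - 4 * A * E)
  simp only [Set.toFinset_setOf] at hs
  rw [hcard, add_comm]
  convert hs using 3

/-- `Σ_α (if Aα² + Bα + E = 0 then p else 0) = p (1 + χ(B² − 4AE))`. -/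
theorem sum_ite_roots (hp2 : p ≠ 2) {A : ZMod p} (hA : A ≠ 0) (B E : ZMod p) :
    ∑ α : ZMod p, (if A * α ^ 2 + B * α + E = 0 then (p : ℤ) else 0) =
      (p : ℤ) * (1 + quadraticChar (ZMod p) (B ^ 2 - 4 * A * E)) := by
  rw [Finset.sum_ite, Finset.sum_const_zero, add_zero, Finset.sum_const, nsmul_eq_mul,
    card_roots hp2 hA, mul_comm]

/-! ## The tangency lemma -/

section Tangency

variable {c : ZMod p} {X₀ ω x y : V p}

/-- **TANGENCY LEMMA.**  For `p ≡ 3 (mod 4)` (`χ(−1) = −1`) the latitude polynomial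
`(E_{x,αy} ω)·X₀` has non-zero discriminant: a double root `α₀` would give a point
`v = E_{α₀} ω` of the sphere with `v ⊥ X₀` and `v ⊥ φ`, `φ = (y·X₀) x − (x·X₀) y ∈ X₀^⊥`, whence
`v ∥ X₀ × φ` and `Q(y) = (λ/(x·X₀))²` — but `−Q(y)` is a square too. -/
theorem disc₀_ne_zero (hp2 : p ≠ 2) (hc : ¬ IsSquare (-c)) (hX : X₀ ⬝ᵥ X₀ = c) (hω : ω ⬝ᵥ ω = c)
    (hx0 : x ≠ 0) (hxx : x ⬝ᵥ x = 0) (hyx : y ⬝ᵥ x = 0) (hy : y ⬝ᵥ y ≠ 0)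
    (hε : quadraticChar (ZMod p) (-1) = -1) :
    coefB x y X₀ ω ^ 2 - 4 * coefA x y X₀ ω * (ω ⬝ᵥ X₀) ≠ 0 := by
  obtain ⟨A, hAdef⟩ : ∃ A, A = coefA x y X₀ ω := ⟨_, rfl⟩
  obtain ⟨B, hBdef⟩ : ∃ B, B = coefB x y X₀ ω := ⟨_, rfl⟩
  rw [← hAdef, ← hBdef]
  intro hD
  have h2 : (2 : ZMod p) ≠ 0 := two_ne_zero_zmod hp2
  have hm0 : x ⬝ᵥ X₀ ≠ 0 := by
    rw [dotProduct_comm]; exact dot_ne_zero_of_isotropic hc hx0 hxx hX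
  have hn0 : ω ⬝ᵥ x ≠ 0 := dot_ne_zero_of_isotropic hc hx0 hxx hω
  have hA0 : A ≠ 0 := by
    rw [hAdef]
    exact neg_ne_zero.mpr (mul_ne_zero (mul_ne_zero (div_ne_zero hy h2) hn0) hm0)
  have h2A' : 2 * A = -((y ⬝ᵥ y) * (ω ⬝ᵥ x) * (x ⬝ᵥ X₀)) := by
    rw [hAdef, coefA]; field_simp
  have hBval : B = (ω ⬝ᵥ x) * (y ⬝ᵥ X₀) - (ω ⬝ᵥ y) * (x ⬝ᵥ X₀) := hBdef
  have h4A : (4 : ZMod p) * A ≠ 0 := by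
    rw [show (4 : ZMod p) * A = 2 * (2 * A) by ring]
    exact mul_ne_zero h2 (mul_ne_zero h2 hA0)
  -- the double root `α₀` and the tangency point `v = E_{α₀} ω`
  obtain ⟨α₀, hα₀⟩ : ∃ α₀ : ZMod p, α₀ = -B / (2 * A) := ⟨_, rfl⟩
  have h2A : 2 * A * α₀ + B = 0 := by
    rw [hα₀]; field_simp; ring
  obtain ⟨v, hvdef⟩ : ∃ v : V p, v = siegel x (α₀ • y) ω := ⟨_, rfl⟩
  have hv1 : v ⬝ᵥ X₀ = 0 := by
    have h4 : 4 * A * (v ⬝ᵥ X₀) = 0 := by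
      rw [hvdef, siegel_smul_dot, ← hAdef, ← hBdef]
      linear_combination (2 * A * α₀ + B) * h2A - hD
    exact (mul_eq_zero.mp h4).resolve_left h4A
  have hvx : v ⬝ᵥ x = ω ⬝ᵥ x := by
    rw [hvdef]; exact siegel_dot_x hxx (by rw [smul_dotProduct, hyx, smul_zero]) ω
  have hvy : v ⬝ᵥ y = ω ⬝ᵥ y + α₀ * ((ω ⬝ᵥ x) * (y ⬝ᵥ y)) := by
    rw [hvdef]; exact siegel_smul_dot_y hyx ω α₀
  have hvv : v ⬝ᵥ v = c := by
    rw [hvdef, siegel_dot_self hp2 hxx (by rw [smul_dotProduct, hyx, smul_zero]), hω]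
  -- `φ = (y·X₀) x − (x·X₀) y ∈ X₀^⊥`, `v ⊥ φ`, `Q(φ) = (x·X₀)² Q(y)`
  obtain ⟨φ, hφ⟩ : ∃ φ : V p, φ = (y ⬝ᵥ X₀) • x - (x ⬝ᵥ X₀) • y := ⟨_, rfl⟩
  have hv2 : v ⬝ᵥ φ = 0 := by
    rw [hφ, dotProduct_sub, dotProduct_smul, dotProduct_smul, smul_eq_mul, smul_eq_mul, hvx, hvy]
    linear_combination h2A - α₀ * h2A' - hBval
  have hφX : φ ⬝ᵥ X₀ = 0 := by
    rw [hφ, sub_dotProduct, smul_dotProduct, smul_dotProduct, smul_eq_mul, smul_eq_mul]; ring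
  have hXφ : X₀ ⬝ᵥ φ = 0 := by rw [dotProduct_comm]; exact hφX
  have hxy : x ⬝ᵥ y = 0 := by rw [dotProduct_comm]; exact hyx
  have hφφ : φ ⬝ᵥ φ = (x ⬝ᵥ X₀) ^ 2 * (y ⬝ᵥ y) := by
    rw [hφ]
    simp only [sub_dotProduct, dotProduct_sub, smul_dotProduct, dotProduct_smul, smul_eq_mul, hxx,
      hyx, hxy]
    ring
  -- `v ∥ X₀ × φ`, so `μ² c = Q(X₀ × φ) = c Q(φ)`
  have hc0 : c ≠ 0 := ne_zero_of_nonsquare hc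
  have hv0 : v ≠ 0 := by
    intro h; apply hc0; rw [← hvv, h, dotProduct_zero]
  have hcross : v ⨯₃ (X₀ ⨯₃ φ) = 0 := by
    rw [cross_cross_eq_smul_sub_smul', hv2, zero_smul, zero_sub, dotProduct_comm X₀ v, hv1,
      zero_smul, neg_zero]
  obtain ⟨μ, hμ⟩ := exists_smul_of_cross_eq_zero hv0 hcross
  have hQ : μ ^ 2 * c = c * ((x ⬝ᵥ X₀) ^ 2 * (y ⬝ᵥ y)) := by
    have h1 : (μ • v) ⬝ᵥ (μ • v) = μ ^ 2 * c := by
      rw [smul_dotProduct, dotProduct_smul, smul_eq_mul, smul_eq_mul, hvv]; ring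
    rw [← h1, hμ, cross_dot_cross, hX, hφφ, hXφ, hφX, mul_zero, sub_zero]
  -- hence `Q(y)` is a square; but so is `−Q(y)`: contradiction with `χ(−1) = −1`
  have hsq : IsSquare (y ⬝ᵥ y) := ⟨μ / (x ⬝ᵥ X₀), by
    field_simp
    have h3 : c * ((x ⬝ᵥ X₀) ^ 2 * (y ⬝ᵥ y)) = c * μ ^ 2 := by rw [← hQ]; ring
    linear_combination mul_left_cancel₀ hc0 h3⟩
  obtain ⟨r, hr⟩ := neg_dot_isSquare_of_perp_isotropic hx0 hxx hyx
  obtain ⟨s, hs⟩ := hsq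
  have hs0 : s ≠ 0 := by rintro rfl; exact hy (by rw [hs, mul_zero])
  have hm1 : IsSquare (-1 : ZMod p) := ⟨r / s, by
    field_simp
    linear_combination hr + hs⟩
  exact absurd hm1 (quadraticChar_neg_one_iff_not_isSquare.mp hε)

end Tangency

/-! ## The unipotent orbit sum -/

/-- A quadratic with vanishing discriminant has a root (`A ≠ 0`, `p ≠ 2`). -/
theorem exists_root_of_disc (hp2 : p ≠ 2) {A : ZMod p} (hA : A ≠ 0) {B E : ZMod p}
    (hD : B ^ 2 - 4 * A * E = 0) : ∃ α : ZMod p, A * α ^ 2 + B * α + E = 0 := by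
  have h2 : (2 : ZMod p) ≠ 0 := two_ne_zero_zmod hp2
  have h4A : (4 : ZMod p) * A ≠ 0 := by
    rw [show (4 : ZMod p) * A = 2 * (2 * A) by ring]
    exact mul_ne_zero h2 (mul_ne_zero h2 hA)
  refine ⟨-B / (2 * A), (mul_eq_zero.mp ?_).resolve_left h4A⟩
  have h1 : 2 * A * (-B / (2 * A)) + B = 0 := by field_simp; ring
  linear_combination (2 * A * (-B / (2 * A)) + B) * h1 - hD

section Main
variable {c : ZMod p} {X₀ ω x y : V p}

/-- **UNIPOTENT ORBIT SUMS VANISH** (ORACLE-g24 §G24-1 (U)): for every odd prime `p`, every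
level `c` with `−c` a non-square, base point `X₀` and point `ω` of the sphere `Q = c`, isotropic
`x ≠ 0` and anisotropic `y ⊥ x`:  `Σ_α wt c X₀ (E_{x,αy} ω) = 0`. -/
theorem orbitU_sum (hp2 : p ≠ 2) (hc : ¬ IsSquare (-c)) (hX : X₀ ⬝ᵥ X₀ = c) (hω : ω ⬝ᵥ ω = c)
    (hx0 : x ≠ 0) (hxx : x ⬝ᵥ x = 0) (hyx : y ⬝ᵥ x = 0) (hy : y ⬝ᵥ y ≠ 0) :
    ∑ α : ZMod p, wt c X₀ (siegel x (α • y) ω) = 0 := by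
  classical
  obtain ⟨A, hAdef⟩ : ∃ A, A = coefA x y X₀ ω := ⟨_, rfl⟩
  obtain ⟨B, hBdef⟩ : ∃ B, B = coefB x y X₀ ω := ⟨_, rfl⟩
  obtain ⟨C, hCdef⟩ : ∃ C, C = ω ⬝ᵥ X₀ := ⟨_, rfl⟩
  have h2 : (2 : ZMod p) ≠ 0 := two_ne_zero_zmod hp2
  have h4 : (4 : ZMod p) ≠ 0 := by
    rw [show (4 : ZMod p) = 2 * 2 by norm_num]; exact mul_ne_zero h2 h2
  have hm0 : x ⬝ᵥ X₀ ≠ 0 := by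
    rw [dotProduct_comm]; exact dot_ne_zero_of_isotropic hc hx0 hxx hX
  have hn0 : ω ⬝ᵥ x ≠ 0 := dot_ne_zero_of_isotropic hc hx0 hxx hω
  have hA0 : A ≠ 0 := by
    rw [hAdef]; exact neg_ne_zero.mpr (mul_ne_zero (mul_ne_zero (div_ne_zero hy h2) hn0) hm0)
  have h2A0 : 2 * A ≠ 0 := mul_ne_zero h2 hA0
  have h2A : 2 * A = -((y ⬝ᵥ y) * (ω ⬝ᵥ x) * (x ⬝ᵥ X₀)) := by rw [hAdef, coefA]; field_simp
  have hnegq : IsSquare (-(y ⬝ᵥ y)) := neg_dot_isSquare_of_perp_isotropic hx0 hxx hyx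
  have hχnegq : quadraticChar (ZMod p) (-(y ⬝ᵥ y)) = 1 :=
    (quadraticChar_one_iff_isSquare (neg_ne_zero.mpr hy)).mpr hnegq
  -- the orbit lies on the sphere, at latitude `t α = Aα² + Bα + C`, and `(E_α ω)·x = ω·x`
  have hS : ∀ α : ZMod p, siegel x (α • y) ω ⬝ᵥ siegel x (α • y) ω = c := fun α => by
    rw [siegel_dot_self hp2 hxx (by rw [smul_dotProduct, hyx, smul_zero]), hω]
  have ht : ∀ α : ZMod p, siegel x (α • y) ω ⬝ᵥ X₀ = A * α ^ 2 + B * α + C := fun α => by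
    rw [siegel_smul_dot, hAdef, hBdef, hCdef]
  have hSx : ∀ α : ZMod p, siegel x (α • y) ω ⬝ᵥ x = ω ⬝ᵥ x := fun α =>
    siegel_dot_x hxx (by rw [smul_dotProduct, hyx, smul_zero]) ω
  -- Step 1: termwise, the weight is the latitude profile at `t α`
  have hterm : ∀ α : ZMod p, wt c X₀ (siegel x (α • y) ω) =
      quadraticChar (ZMod p) (-1) *
          (quadraticChar (ZMod p) ((2 * A) * α ^ 2 + (2 * B) * α + (2 * c + 2 * C)) -
            quadraticChar (ZMod p) ((-(2 * A)) * α ^ 2 + (-(2 * B)) * α + (2 * c - 2 * C))) +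
        (1 - quadraticChar (ZMod p) (-1)) *
          quadraticChar (ZMod p) ((2 * A) * α ^ 2 + (2 * B) * α + 2 * C) +
        ((if A * α ^ 2 + B * α + (C - c) = 0 then (p : ℤ) else 0) -
          (if A * α ^ 2 + B * α + (C + c) = 0 then (p : ℤ) else 0)) := by
    intro α
    rw [wt_eq_lat hc hX (hS α), ht α, lat]
    simp only [chi_eq]
    have e1 : 2 * c + 2 * (A * α ^ 2 + B * α + C) = 2 * A * α ^ 2 + 2 * B * α + (2 * c + 2 * C) := by
      ring
    have e2 : 2 * c - 2 * (A * α ^ 2 + B * α + C) =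
        -(2 * A) * α ^ 2 + -(2 * B) * α + (2 * c - 2 * C) := by ring
    have e3 : 2 * (A * α ^ 2 + B * α + C) = 2 * A * α ^ 2 + 2 * B * α + 2 * C := by ring
    have i1 : A * α ^ 2 + B * α + C = c ↔ A * α ^ 2 + B * α + (C - c) = 0 := by
      constructor <;> intro h <;> linear_combination h
    have i2 : A * α ^ 2 + B * α + C = -c ↔ A * α ^ 2 + B * α + (C + c) = 0 := by
      constructor <;> intro h <;> linear_combination h
    rw [e1, e2, e3]
    simp only [i1, i2]
  simp_rw [hterm]
  simp only [Finset.sum_add_distrib, Finset.sum_sub_distrib, ← Finset.mul_sum]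
  -- Step 2: evaluate the five sums
  rw [sum_quadratic hp2 h2A0, sum_quadratic hp2 (neg_ne_zero.mpr h2A0), sum_quadratic hp2 h2A0,
    sum_ite_roots hp2 hA0, sum_ite_roots hp2 hA0]
  have eP : (2 * B) ^ 2 - 4 * (2 * A) * (2 * c + 2 * C) = 4 * (B ^ 2 - 4 * A * (C + c)) := by ring
  have eM : (-(2 * B)) ^ 2 - 4 * (-(2 * A)) * (2 * c - 2 * C) = 4 * (B ^ 2 - 4 * A * (C - c)) := by
    ring
  have e0 : (2 * B) ^ 2 - 4 * (2 * A) * (2 * C) = 4 * (B ^ 2 - 4 * A * C) := by ring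
  rw [eP, eM, e0]
  simp only [mul_eq_zero, h4, false_or]
  rw [show quadraticChar (ZMod p) (-(2 * A)) =
      quadraticChar (ZMod p) (-1) * quadraticChar (ZMod p) (2 * A) by
    rw [neg_eq_neg_one_mul, map_mul]]
  -- Step 3: the structural facts
  obtain ⟨ε, hεdef⟩ : ∃ ε : ℤ, ε = quadraticChar (ZMod p) (-1) := ⟨_, rfl⟩
  obtain ⟨a₂, ha₂def⟩ : ∃ a : ℤ, a = quadraticChar (ZMod p) (2 * A) := ⟨_, rfl⟩
  rw [← hεdef, ← ha₂def]
  have hε : ε = 1 ∨ ε = -1 := hεdef ▸ quadraticChar_dichotomy (neg_ne_zero.mpr one_ne_zero)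
  have ha₂ : a₂ = 1 ∨ a₂ = -1 := ha₂def ▸ quadraticChar_dichotomy h2A0
  -- (a) freeness: at most one `α` with `E_α ω = ±X₀`, so `χ(D∓) ≠ 1`
  have hle : ∀ (Z : V p), (Finset.univ.filter fun α : ZMod p => siegel x (α • y) ω = Z).card ≤ 1 :=
    fun Z => Finset.card_le_one.mpr fun α hα β hβ => siegel_smul_inj hyx hy hn0
      ((Finset.mem_filter.mp hα).2.trans (Finset.mem_filter.mp hβ).2.symm)
  have hχm : B ^ 2 - 4 * A * (C - c) ≠ 0 → quadraticChar (ZMod p) (B ^ 2 - 4 * A * (C - c)) = -1 := by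
    intro hD
    refine (quadraticChar_dichotomy hD).resolve_left fun h1 => ?_
    have hcard := card_roots hp2 hA0 B (C - c)
    have hsub : (Finset.univ.filter fun α : ZMod p => A * α ^ 2 + B * α + (C - c) = 0) ⊆
        (Finset.univ.filter fun α : ZMod p => siegel x (α • y) ω = X₀) := by
      intro α hα
      simp only [Finset.mem_filter, Finset.mem_univ, true_and] at hα ⊢
      exact (eq_base_iff hc hX (hS α)).mpr (by rw [ht α]; linear_combination hα)
    have := (Nat.cast_le (α := ℤ)).mpr ((Finset.card_le_card hsub).trans (hle X₀))
    rw [hcard, h1] at this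
    norm_num at this
  have hχp : B ^ 2 - 4 * A * (C + c) ≠ 0 → quadraticChar (ZMod p) (B ^ 2 - 4 * A * (C + c)) = -1 := by
    intro hD
    refine (quadraticChar_dichotomy hD).resolve_left fun h1 => ?_
    have hcard := card_roots hp2 hA0 B (C + c)
    have hsub : (Finset.univ.filter fun α : ZMod p => A * α ^ 2 + B * α + (C + c) = 0) ⊆
        (Finset.univ.filter fun α : ZMod p => siegel x (α • y) ω = -X₀) := by
      intro α hα
      simp only [Finset.mem_filter, Finset.mem_univ, true_and] at hα ⊢
      exact (eq_neg_base_iff hc hX (hS α)).mpr (by rw [ht α]; linear_combination hα)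
    have := (Nat.cast_le (α := ℤ)).mpr ((Finset.card_le_card hsub).trans (hle (-X₀)))
    rw [hcard, h1] at this
    norm_num at this
  -- (b) a vanishing discriminant puts `±X₀` on the orbit and pins `χ(2A)`
  have hnm : B ^ 2 - 4 * A * (C - c) = 0 → ω ⬝ᵥ x = x ⬝ᵥ X₀ := by
    intro hD
    obtain ⟨α₁, hα₁⟩ := exists_root_of_disc hp2 hA0 hD
    have hE : siegel x (α₁ • y) ω = X₀ :=
      (eq_base_iff hc hX (hS α₁)).mpr (by rw [ht α₁]; linear_combination hα₁)
    rw [← hSx α₁, hE, dotProduct_comm]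
  have hnp : B ^ 2 - 4 * A * (C + c) = 0 → ω ⬝ᵥ x = -(x ⬝ᵥ X₀) := by
    intro hD
    obtain ⟨α₁, hα₁⟩ := exists_root_of_disc hp2 hA0 hD
    have hE : siegel x (α₁ • y) ω = -X₀ :=
      (eq_neg_base_iff hc hX (hS α₁)).mpr (by rw [ht α₁]; linear_combination hα₁)
    rw [← hSx α₁, hE, neg_dotProduct, dotProduct_comm]
  have ha₂m : B ^ 2 - 4 * A * (C - c) = 0 → a₂ = 1 := by
    intro hD
    rw [ha₂def, h2A, hnm hD, show -((y ⬝ᵥ y) * (x ⬝ᵥ X₀) * (x ⬝ᵥ X₀)) =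
      (-(y ⬝ᵥ y)) * (x ⬝ᵥ X₀) ^ 2 by ring, map_mul, quadraticChar_sq_one' hm0, mul_one, hχnegq]
  have ha₂p : B ^ 2 - 4 * A * (C + c) = 0 → a₂ = ε := by
    intro hD
    rw [ha₂def, h2A, hnp hD, show -((y ⬝ᵥ y) * -(x ⬝ᵥ X₀) * (x ⬝ᵥ X₀)) =
      (-1) * (-(y ⬝ᵥ y)) * (x ⬝ᵥ X₀) ^ 2 by ring, map_mul, map_mul, quadraticChar_sq_one' hm0,
      mul_one, hχnegq, mul_one, hεdef]
  have hboth : B ^ 2 - 4 * A * (C - c) = 0 → B ^ 2 - 4 * A * (C + c) = 0 → False := by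
    intro h₁ h₂
    have : (2 : ZMod p) * (x ⬝ᵥ X₀) = 0 := by linear_combination hnp h₂ - hnm h₁
    exact hm0 ((mul_eq_zero.mp this).resolve_left h2)
  -- (c) tangency: for `χ(−1) = −1` the middle discriminant is non-zero
  have htan : ε = -1 → B ^ 2 - 4 * A * C ≠ 0 := by
    intro h
    have := disc₀_ne_zero hp2 hc hX hω hx0 hxx hyx hy (by rw [← hεdef, h])
    rwa [← hAdef, ← hBdef, ← hCdef] at this
  -- Step 4: bookkeeping
  by_cases hDm0 : B ^ 2 - 4 * A * (C - c) = 0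
  · have hDp0 : B ^ 2 - 4 * A * (C + c) ≠ 0 := fun h => hboth hDm0 h
    rw [if_pos hDm0, if_neg hDp0, hDm0, hχp hDp0, MulChar.map_zero, ha₂m hDm0]
    rcases hε with h | h
    · rw [h]; split_ifs <;> ring
    · rw [h, if_neg (htan h)]; ring
  · by_cases hDp0 : B ^ 2 - 4 * A * (C + c) = 0
    · rw [if_neg hDm0, if_pos hDp0, hDp0, hχm hDm0, MulChar.map_zero, ha₂p hDp0]
      rcases hε with h | h
      · rw [h]; split_ifs <;> ring
      · rw [h, if_neg (htan h)]; ring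
    · rw [if_neg hDm0, if_neg hDp0, hχm hDm0, hχp hDp0]
      rcases hε with h | h
      · rw [h]; split_ifs <;> ring
      · rw [h, if_neg (htan h)]; ring
end Main

end ReflectionClassOrbitU
end Summit.MatrixMultiplication.MatrixMultiplication.Theorems.SubgroupIdentityDesigns.Negative
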